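import Literature.Analysis.FluidPDE.LocalLerayLimitSlabBounds
import Literature.Analysis.FluidPDE.LocalLerayLimitWeakContinuity
import Literature.Analysis.FluidPDE.NSSereginLimitDecayHolds
import HarnessLib

/-!
# Discharge of `localLeray_limit_isLocalLeraySolution` (the identification of the limit of local
# Leray solutions; Jia–Šverák 2013, proof of Thm. 1) through `seregin2014_limit_decay`

Analysis/FluidPDE proof file (theorems only: no definitions, no named facts), third of three files
(`LocalLerayLimitSlabBounds`, `LocalLerayLimitWeakContinuity`, this file) **discharging** the named
fact `Literature.Analysis.FluidPDE.localLeray_limit_isLocalLeraySolution` (**Lim**,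
`LocalLerayLimitingProcedure.lean`): H. Jia, V. Šverák, SIAM J. Math. Anal. 45 (2013) =
arXiv:1201.1592, proof of Thm. 1, p. 8 — "`u^k(·, t) ⇀ u(·, t)` in `L²(B₁(x₀))` for every `t` …
From estimate (4.22) and the weak convergence … `sup_{x₀} ‖u(·, t) − e^{Δt}u₀‖_{L²(B₁(x₀))} ≤ h(t)`
… `u(·, t) → u₀` in `L²(B₁(x₀))` … Thus `u` satisfies the decay condition … `u` is a Leray
solution with initial data `u₀`"; P. G. Lemarié-Rieusset (2016), proof of Thm. 15.5, p. 571;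
G. Seregin (2014), Ch. 7 (7.3.6)–(7.3.12) and App. B §B.4; the decay (7) of the limit:
Kikuchi–Seregin 2007, Thm. 1.4 = Seregin 2014, Thm. 1.6 = Kang–Miura–Tsai 2021, Lemma 3.3.
**Lim** is one of the four live leaves of the cone of `rusin_sverak_minimal_blowup`
(Rusin–Šverák 2011, Cor. 4.3; `RusinSverakWeakLimitBlowupFourLeaves.lean`). Main results:

* `localLeray_limit_isLocalLeraySolution_of_limit_decay : seregin2014_limit_decay → Lim`;
* `localLeray_limit_isLocalLeraySolution_holds : Lim` — with the discharge
  `seregin2014_limit_decay_holds` (`NSSereginLimitDecayHolds.lean`).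

## The proof (following Jia–Šverák p. 8 / Lemarié-Rieusset p. 571 / Seregin §7.3, §B.4)

Let `(v_k, q_k) ∈ 𝒩(a_k)` with the Cor.-1 bounds, the uniform pressure bounds, the uniform
initial layer `h`, `a_k ⇀ a'`, and `(v_k, q_k) → (U, P)` in the situation of Rusin–Šverák's
Prop. 2.2 on the open slab with `(U, P)` suitable.

1. *Bounds and convergences up to `t = 0`* (`LocalLerayLimitSlabBounds.lean`): a.e.-in-time
   unit-ball bounds `A(S) = C (ρ_S + 2)` for the `v_k` and for `U`; `v_k → U` in `L²` of boxes
   `(0,T) × B_R(x₀)`; `P ∈ L^{3/2}` of boxes with `q_k ⇀ P` there; the weak gradient of `U` with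
   the Cor.-1 bound; `|U|³ ∈ L¹` of boxes; the local pressure expansion (B.1.9) of the limit.
2. *The weakly continuous representative* `U'` of `U` (`LocalLerayLimitWeakContinuity.lean`),
   `U' = U` at a.e. time, every-time unit-ball bounds, pairings continuous on `(0,∞)` and equal to
   the essential limits of the pairings of `U`; the final field is `U'` for `t > 0` and `a'` at
   `t ≤ 0`.
3. *Traces (full sequence).* For a test field `φ` and `t₀ > 0`, the essential left limits `ℓ_k`
   of `t ↦ ∫⟪v_k(t), φ⟫` are the values at `t₀` of the continuous versions `V_k`
   (du Bois-Reymond), which are equicontinuous at `t₀` uniformly in `k`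
   (`exists_modulus_slab`: `|V_k t₀ − V_k s| ≤ K (t₀ − s)^{1/3}`), and `V_k → V_U` in
   `L¹(t₀ − δ, t₀)` by the `L²` convergence of `v_k` on boxes; averaging over `(t₀ − δ, t₀)` gives
   `ℓ_k → V_U(t₀) = ∫⟪U'(t₀), φ⟫`.
4. *The datum.* At a.e. `t ∈ (0,1)` (layer-good times: the layer bound for all `k` and all
   centres of a dense sequence, good slices, and `v_k(t)` equal to its weakly continuous
   representative) the pairings of `v_k(t)` converge to those of `U'(t)` by step 3, so the
   uniform layer passes to the limit (`eLpNorm_sub_heatTest_le_of_tendsto`):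
   `‖U'(t) − e^{tΔ}a'‖_{L²(B(d_i,1))} ≤ h(t)`, hence `∫_{B(d_i,1)} |U'(t) − a'|² ≤ Φ(t)²`,
   `Φ = h + |B₁|^{1/6} ‖e^{tΔ}a' − a'‖₃ → 0` (strong continuity of the heat semigroup on `L³`);
   at the remaining times the bound `≤ ε'` near `0` follows by weak lower semicontinuity along
   a.e. `s → t` (`lintegral_unitBall_le_of_tendsto_pairing`); a finite cover of the compact `K`
   by unit balls with centres `d_i` gives `∫_K |U'(t) − a'|² → 0`, and weak continuity at `0⁺`.
5. *Decay.* On every `(0, T)` the pair `(U', P)` satisfies the clauses of Seregin's Def. B.1 with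
   the expansion (B.1.9), so `seregin2014_limit_decay` gives the decay (7); with steps 1–4 this is
   `IsLocalLeraySolution 1 a' U' P`, the continuity of the pairings and the trace clause.

## Mathlib / tree search

Tree (all proved, reused): `LocalLerayLimit.*` of the two sibling files;
`eLpNorm_sub_heatTest_le_of_tendsto`, `memLp_two_heatTest_restrict_ball`,
`IsWeaklyDivFree.of_tendsto_integral_inner`, `seregin2014_limit_decay` (`NSSereginMildCompactness`);
`seregin2014_limit_decay_holds` (`NSSereginLimitDecayHolds`); `tendsto_heatFlow_nhdsWithin_zero_holds`
(`MildSolutionHeatFlowProofs`); `memE2_of_memLp` (`LocalLerayExistence`);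
`IsSuitableWeakSolutionOn.congr_ae`, `HasWeakSpatialGradientOn.congr_ae` (`SuitableWeakCongr`);
`IsSuitableWeakSolutionOn.of_le`, `IsLocalLeraySolution.isLocalLeraySolutionOn`
(`SuitableWeakRescaling`, `LocalLeraySolutionsSlab`); `nhdsLT_inf_ae_neBot`, `nhds_inf_ae_neBot`;
`localPressureNear_apply`, `localPressureFar_apply`; `lintegral_biUnion_finset_le_card_mul`.
`lean search 'localLeray_limit_isLocalLeraySolution_holds'`: nothing before this file (the name
appears only in docstrings of `LerayL3WeakStabilityThreeLeaves.lean`). Mathlib: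
`Metric.tendsto_nhds`, `mem_nhdsGT_iff_exists_Ioo_subset`, `IsCompact.elim_finite_subcover`,
`tendsto_iff_edist_tendsto_0`, `continuousWithinAt_Ioi_iff_Ici`, `ENNReal.mul_le_mul_iff_left`.

## References

* H. Jia, V. Šverák, SIAM J. Math. Anal. 45 (2013) 1448–1459 = arXiv:1201.1592: Lemma 8 and the
  proof of Thm. 1, p. 8. [JiaSverak2013]
* G. Seregin, *Lecture Notes on Regularity Theory for the Navier–Stokes Equations*, World
  Scientific (2014), doi:10.1142/9314: Ch. 7 §7.3 (7.3.2)–(7.3.12) (PDF pp. 135–137); App. B,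
  Def. B.1, Thm. 1.6, §B.4 (B.4.1)–(B.4.16) (PDF pp. 150–163). [Seregin2014]
* P. G. Lemarié-Rieusset, *The Navier–Stokes Problem in the 21st Century*, CRC Press (2016),
  doi:10.1201/b19556: proof of Thm. 15.5, PDF pp. 570–571. [LemarieRieusset2016]
* W. Rusin, V. Šverák, J. Funct. Anal. 260 (2011) = arXiv:0911.0500, Prop. 2.2, Cor. 4.3.
  [RusinSverak2011]
* K. Kang, H. Miura, T.-P. Tsai, IMRN 2021 = arXiv:1812.10509, §3: Def. 3.1–3.2, Lemmas 3.3–3.4.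
  [KangMiuraTsai2020]
* N. Kikuchi, G. Seregin, AMS Transl. (2) 220 (2007), Thm. 1.4, Lemma 2.2.
-/

noncomputable section

open MeasureTheory TopologicalSpace Set Function Filter Metric
open _root_.Topology
open scoped ENNReal NNReal RealInnerProductSpace

namespace Literature.Analysis.FluidPDE

namespace LocalLerayLimit

/-! ### Glue -/

/-- Slices a.e. equal in time give fields a.e. equal on the slab (the exceptional times form a
null set, whose product with `ℝ³` is null). [folklore] -/
theorem ae_eq_uncurry_of_ae_eq_slice {I : Set ℝ} (hI : MeasurableSet I)
    {f g : ℝ → EuclideanSpace ℝ (Fin 3) → EuclideanSpace ℝ (Fin 3)}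
    (h : ∀ᵐ t ∂(volume.restrict I), f t = g t) :
    uncurry f =ᵐ[volume.restrict (I ×ˢ (univ : Set (EuclideanSpace ℝ (Fin 3))))] uncurry g := by
  set N : Set ℝ := {t | ¬ f t = g t} with hN
  have hN0 : volume (N ∩ I) = 0 := by
    have h1 : (volume.restrict I) N = 0 := ae_iff.1 h
    rwa [Measure.restrict_apply' hI] at h1
  have hprod : volume ((N ∩ I) ×ˢ (univ : Set (EuclideanSpace ℝ (Fin 3)))) = 0 := by
    rw [Measure.volume_eq_prod, Measure.prod_prod, hN0, zero_mul]
  rw [Filter.EventuallyEq, ae_restrict_iff' (hI.prod MeasurableSet.univ)]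
  have h2 : ∀ᵐ z ∂(volume : Measure (ℝ × EuclideanSpace ℝ (Fin 3))),
      z ∉ (N ∩ I) ×ˢ (univ : Set (EuclideanSpace ℝ (Fin 3))) := by
    rw [ae_iff]; simp only [not_not, setOf_mem_eq]; exact hprod
  filter_upwards [h2] with z hz hzI
  have ht : z.1 ∉ N := fun h' => hz ⟨⟨h', hzI.1⟩, mem_univ _⟩
  have hfg : f z.1 = g z.1 := by
    by_contra h'
    exact ht h'
  show f z.1 z.2 = g z.1 z.2
  rw [hfg]

/-- `∫_{B(x₀,1)} |f|² ≤ ‖f‖₃² |B₁|^{1/3}` for `f ∈ L³` (Hölder on the unit ball). [folklore] -/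
theorem lintegral_unitBall_sq_le_of_memLp_three
    {f : EuclideanSpace ℝ (Fin 3) → EuclideanSpace ℝ (Fin 3)} (hf : MemLp f 3 volume)
    (x₀ : EuclideanSpace ℝ (Fin 3)) :
    ∫⁻ x in ball x₀ 1, ‖f x‖ₑ ^ 2 ≤
      eLpNorm f 3 volume ^ 2 * volume (ball (0 : EuclideanSpace ℝ (Fin 3)) 1) ^ (1 / 3 : ℝ) := by
  set μB : Measure (EuclideanSpace ℝ (Fin 3)) := volume.restrict (ball x₀ 1) with hμB
  have hm : AEStronglyMeasurable f μB := hf.1.restrict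
  have h1 : eLpNorm f 2 μB ≤ eLpNorm f 3 μB * μB univ ^ (1 / (2 : ℝ≥0∞).toReal - 1 / (3 : ℝ≥0∞).toReal) :=
    eLpNorm_le_eLpNorm_mul_rpow_measure_univ (by norm_num) hm
  have hr : (1 / (2 : ℝ≥0∞).toReal - 1 / (3 : ℝ≥0∞).toReal : ℝ) = 1 / 6 := by
    rw [ENNReal.toReal_ofNat, ENNReal.toReal_ofNat]; norm_num
  have hμ : μB univ = volume (ball (0 : EuclideanSpace ℝ (Fin 3)) 1) := by
    rw [hμB, Measure.restrict_apply_univ]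
    exact Measure.addHaar_ball_center volume x₀ 1
  rw [hr, hμ] at h1
  have h3 : eLpNorm f 3 μB ≤ eLpNorm f 3 volume := eLpNorm_mono_measure _ Measure.restrict_le_self
  calc ∫⁻ x in ball x₀ 1, ‖f x‖ₑ ^ 2 = eLpNorm f 2 μB ^ 2 := lintegral_enorm_sq_eq_eLpNorm_two_pow μB f
    _ ≤ (eLpNorm f 3 volume * volume (ball (0 : EuclideanSpace ℝ (Fin 3)) 1) ^ (1 / 6 : ℝ)) ^ 2 := by
        refine pow_le_pow_left' (h1.trans ?_) 2
        gcongr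
    _ = eLpNorm f 3 volume ^ 2 * volume (ball (0 : EuclideanSpace ℝ (Fin 3)) 1) ^ (1 / 3 : ℝ) := by
        rw [mul_pow, ← ENNReal.rpow_natCast (volume _ ^ (1 / 6 : ℝ)) 2, ← ENNReal.rpow_mul]
        norm_num

/-- The constants `A(S) = C (ρ_S + 2)`, `ρ_S = max 1 √S`, are monotone in `S`. [folklore] -/
theorem monotone_boundConst (C : ℝ≥0) :
    Monotone fun S : ℝ => C * (max 1 (Real.sqrt S) + 2).toNNReal := by
  intro S S' h
  have h1 : max 1 (Real.sqrt S) + 2 ≤ max 1 (Real.sqrt S') + 2 := by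
    have := max_le_max (le_refl (1 : ℝ)) (Real.sqrt_le_sqrt h)
    linarith
  exact mul_le_mul' le_rfl (Real.toNNReal_le_toNNReal h1)

/-- `C · r = ↑(C · r.toNNReal)` in `ℝ≥0∞` for `r` real (the coercion used by the Cor.-1 bounds).
[folklore] -/
theorem coe_mul_ofReal (C : ℝ≥0) (r : ℝ) :
    (C : ℝ≥0∞) * ENNReal.ofReal r = ((C * r.toNNReal : ℝ≥0) : ℝ≥0∞) := by
  rw [ENNReal.coe_mul]; rfl


end LocalLerayLimit

open LocalLerayLimit

/-! ### The reduction `seregin2014_limit_decay → localLeray_limit_isLocalLeraySolution` -/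

set_option maxHeartbeats 1600000 in
/-- **The limit of local Leray solutions is a local Leray solution with the weak-limit datum,
weakly continuous in time, and its slices are the limits of the traces**
(`localLeray_limit_isLocalLeraySolution`; Jia–Šverák 2013, proof of Thm. 1, p. 8;
Lemarié-Rieusset 2016, p. 571; Seregin 2014, (7.3.6)–(7.3.12), §B.4) **from the decay of local
energy solutions** (`seregin2014_limit_decay`; Seregin 2014, Thm. 1.6 = Kikuchi–Seregin 2007,
Thm. 1.4 = Kang–Miura–Tsai 2021, Lemma 3.3). The module docstring describes the five steps
(bounds up to `t = 0`, the weakly continuous representative, traces by equicontinuity and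
averaging, the datum through the uniform layer and weak lower semicontinuity, the decay by
Thm. 1.6 on every `(0,T)`). [cite: JiaSverak2013, proof of Thm. 1 (arXiv:1201.1592 p. 8) with Cor. 1 and (4.22)] [cite: Seregin2014, Ch. 7 §7.3 (7.3.6)–(7.3.12) and App. B §B.4, Thm. 1.6] [cite: LemarieRieusset2016, proof of Thm. 15.5, p. 571] -/
theorem localLeray_limit_isLocalLeraySolution_of_limit_decay (hLD : seregin2014_limit_decay) :
    localLeray_limit_isLocalLeraySolution := by
  intro M C h a v q a' U P ha hv hE hG hP hh hL ha' hw hCS hS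
  -- ### notation and measurability
  have hslab : ((slab (EuclideanSpace ℝ (Fin 3)) (Ioi 0) isOpen_Ioi : Opens (ℝ × EuclideanSpace ℝ (Fin 3))) :
      Set (ℝ × EuclideanSpace ℝ (Fin 3))) = Ioi (0 : ℝ) ×ˢ univ := rfl
  have hvm : ∀ k, AEStronglyMeasurable (uncurry (v k))
      (volume.restrict (Ioi (0 : ℝ) ×ˢ (univ : Set (EuclideanSpace ℝ (Fin 3))))) :=
    fun k => (hv k).aestronglyMeasurable
  have hUsol : IsDistributionalNSSolutionOn (slab (EuclideanSpace ℝ (Fin 3)) (Ioi 0) isOpen_Ioi) 1 0 U P :=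
    hS.distributional
  have hvsol : ∀ k, IsDistributionalNSSolutionOn (slab (EuclideanSpace ℝ (Fin 3)) (Ioi 0) isOpen_Ioi) 1 0 (v k) (q k) :=
    fun k => (hv k).distributional
  have hUm : AEStronglyMeasurable (uncurry U)
      (volume.restrict (Ioi (0 : ℝ) ×ˢ (univ : Set (EuclideanSpace ℝ (Fin 3))))) := by
    rw [← hslab]; exact hUsol.1.aestronglyMeasurable
  have hPm : AEStronglyMeasurable (uncurry P)
      (volume.restrict (Ioi (0 : ℝ) ×ˢ (univ : Set (EuclideanSpace ℝ (Fin 3))))) := by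
    rw [← hslab]; exact hUsol.2.2.1.aestronglyMeasurable
  have hqm : ∀ k, AEStronglyMeasurable (uncurry (q k))
      (volume.restrict (Ioi (0 : ℝ) ×ˢ (univ : Set (EuclideanSpace ℝ (Fin 3))))) := fun k => by
    rw [← hslab]; exact (hvsol k).2.2.1.aestronglyMeasurable
  have hconv : ∀ K ⊆ Ioi (0 : ℝ) ×ˢ (univ : Set (EuclideanSpace ℝ (Fin 3))), IsCompact K →
      Tendsto (fun k => ∫⁻ z in K, ‖v k z.1 z.2 - U z.1 z.2‖ₑ ^ (3 : ℕ)) atTop (𝓝 0) :=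
    fun K hK hKc => hCS.tendsto_lintegral K (by rwa [hslab]) hKc
  have hPK : ∀ K ⊆ Ioi (0 : ℝ) ×ˢ (univ : Set (EuclideanSpace ℝ (Fin 3))), IsCompact K →
      ∫⁻ z in K, ‖P z.1 z.2‖ₑ ^ (3 / 2 : ℝ) < ∞ := fun K hK hKc => hS.pressure K (by rwa [hslab]) hKc
  have hwP : ∀ K ⊆ Ioi (0 : ℝ) ×ˢ (univ : Set (EuclideanSpace ℝ (Fin 3))), IsCompact K →
      ∀ ψ : ℝ × EuclideanSpace ℝ (Fin 3) → ℝ, MemLp ψ 3 (volume.restrict K) →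
        Tendsto (fun k => ∫ z in K, q k z.1 z.2 * ψ z) atTop (𝓝 (∫ z in K, P z.1 z.2 * ψ z)) :=
    fun K hK hKc => hCS.tendsto_integral_pressure K (by rwa [hslab]) hKc
  -- ### the uniform unit-ball bounds `A S = C (ρ_S + 2)`, a.e. in time on `(0, S)`
  set A : ℝ → ℝ≥0 := fun S => C * (max 1 (Real.sqrt S) + 2).toNNReal with hA_def
  have hAmono : Monotone A := monotone_boundConst C
  have hvA : ∀ k (S : ℝ), ∀ᵐ t ∂(volume.restrict (Ioo (0 : ℝ) S)), ∀ x₀ : EuclideanSpace ℝ (Fin 3),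
      ∫⁻ x in ball x₀ 1, ‖v k t x‖ₑ ^ 2 ≤ A S := by
    intro k S
    filter_upwards [ae_forall_lintegral_unitBall_le (hE k) S] with t ht x₀
    refine (ht x₀).trans (ENNReal.coe_le_coe.2 ?_)
    exact mul_le_mul' le_rfl (Real.toNNReal_le_toNNReal (by linarith))
  have hUA : ∀ S : ℝ, ∀ᵐ t ∂(volume.restrict (Ioo (0 : ℝ) S)), ∀ x₀ : EuclideanSpace ℝ (Fin 3),
      ∫⁻ x in ball x₀ 1, ‖U t x‖ₑ ^ 2 ≤ A S := fun S =>
    ae_forall_lintegral_unitBall_limit_le hE hvm hUm hconv S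
  -- ### `L²` convergence on boxes up to `t = 0`
  have hL2 : ∀ (T : ℝ) (x₀ : EuclideanSpace ℝ (Fin 3)) (R : ℝ),
      Tendsto (fun k => ∫⁻ z in Ioo 0 T ×ˢ ball x₀ R, ‖v k z.1 z.2 - U z.1 z.2‖ₑ ^ 2) atTop (𝓝 0) :=
    fun T x₀ R => tendsto_lintegral_sq_box (A := A T) ENNReal.coe_ne_top hvm hUm (fun k => hvA k T) (hUA T) hconv x₀ R
  -- ### the pressure up to `t = 0`
  have hPbox : ∀ T R : ℝ, 0 < T → 0 < R → ∃ D : ℝ≥0,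
      (∀ k, ∫⁻ z in Ioo (0 : ℝ) T ×ˢ ball (0 : EuclideanSpace ℝ (Fin 3)) R, ‖q k z.1 z.2‖ₑ ^ (3 / 2 : ℝ) ≤ D) ∧
      (∫⁻ z in Ioo (0 : ℝ) T ×ˢ ball (0 : EuclideanSpace ℝ (Fin 3)) R, ‖P z.1 z.2‖ₑ ^ (3 / 2 : ℝ) ≤ D) ∧
      ∀ g : ℝ × EuclideanSpace ℝ (Fin 3) → ℝ,
        MemLp g 3 (volume.restrict (Ioo (0 : ℝ) T ×ˢ ball (0 : EuclideanSpace ℝ (Fin 3)) R)) →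
          Tendsto (fun k => ∫ z in Ioo (0 : ℝ) T ×ˢ ball (0 : EuclideanSpace ℝ (Fin 3)) R, q k z.1 z.2 * g z)
            atTop (𝓝 (∫ z in Ioo (0 : ℝ) T ×ˢ ball (0 : EuclideanSpace ℝ (Fin 3)) R, P z.1 z.2 * g z)) := by
    intro T R hT hR
    obtain ⟨D, hD⟩ := hP T R hT hR
    exact ⟨D, hD, pressure_box_of_weakLimit hqm hPm hPK hwP hD⟩
  have hPfin : ∀ T : ℝ, 0 < T → ∀ K : Set (EuclideanSpace ℝ (Fin 3)), IsCompact K →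
      ∫⁻ z in Ioo 0 T ×ˢ K, ‖P z.1 z.2‖ₑ ^ (3 / 2 : ℝ) < ∞ := by
    intro T hT K hK
    obtain ⟨R, hR⟩ := hK.isBounded.subset_ball (0 : EuclideanSpace ℝ (Fin 3))
    obtain ⟨D, -, hPD, -⟩ := hPbox T (max R 1) hT (by positivity)
    refine lt_of_le_of_lt (lintegral_mono_set (Set.prod_mono Subset.rfl
      (hR.trans (ball_subset_ball (le_max_left _ _))))) (hPD.trans_lt ENNReal.coe_lt_top)
  -- ### the weak gradient of `U` with the Cor.-1 bound
  obtain ⟨GU, hGU, -, -⟩ := hS.localEnergy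
  choose Gv hGv hGvb using hG
  have hcube2 : ∀ (w : ℝ → EuclideanSpace ℝ (Fin 3) → EuclideanSpace ℝ (Fin 3)),
      AEStronglyMeasurable (uncurry w) (volume.restrict (Ioi (0 : ℝ) ×ˢ (univ : Set (EuclideanSpace ℝ (Fin 3))))) →
      (∀ S : ℝ, ∀ᵐ t ∂(volume.restrict (Ioo (0 : ℝ) S)), ∀ x₀ : EuclideanSpace ℝ (Fin 3),
        ∫⁻ x in ball x₀ 1, ‖w t x‖ₑ ^ 2 ≤ A S) →
      ∀ (T : ℝ) (x₀ : EuclideanSpace ℝ (Fin 3)) (R : ℝ),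
        ∫⁻ z in Ioo 0 T ×ˢ ball x₀ R, ‖w z.1 z.2‖ₑ ^ 2 < ∞ := by
    intro w hwm hwA T x₀ R
    obtain ⟨N, hN, -⟩ := Seregin2014Limit.exists_cover_const R
    have hsub := Ioo_prod_ball_subset_slab T x₀ R
    have hm : AEMeasurable (fun z : ℝ × EuclideanSpace ℝ (Fin 3) => ‖w z.1 z.2‖ₑ ^ 2)
        (volume.restrict (Ioo (0 : ℝ) T ×ˢ ball x₀ R)) :=
      ((hwm.mono_measure (Measure.restrict_mono hsub le_rfl)).enorm.pow_const 2)
    refine lt_of_le_of_lt (lintegral_prod_le_of_ae_slice hm ((hwA T).mono fun t ht => hN _ _ ht x₀)) ?_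
    rw [Real.volume_Ioo]
    exact ENNReal.mul_lt_top (ENNReal.mul_lt_top (ENNReal.natCast_lt_top N) ENNReal.coe_lt_top) ENNReal.ofReal_lt_top
  have hGUb : ∀ r : ℝ, 0 < r → ∀ x₀ : EuclideanSpace ℝ (Fin 3),
      ∫⁻ z in Ioo 0 (r ^ 2) ×ˢ ball x₀ r, ENNReal.ofReal (frobeniusNormSq (GU z.1 z.2)) ≤ C * ENNReal.ofReal r :=
    fun r hr x₀ => lintegral_gradient_box_le hGv hGvb hGU hvm hUm
      (fun k r _ x₀ => hcube2 (v k) (hvm k) (hvA k) (r ^ 2) x₀ r)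
      (fun r _ x₀ => hcube2 U hUm hUA (r ^ 2) x₀ r) (fun r _ x₀ => hL2 (r ^ 2) x₀ r) hr x₀
  -- unit-cylinder form on `(0, T)`: radius `ρ_T + 1`
  have hGUunit : ∀ T : ℝ, ∀ x₀ : EuclideanSpace ℝ (Fin 3),
      ∫⁻ z in Ioo 0 T ×ˢ ball x₀ 1, ENNReal.ofReal (frobeniusNormSq (GU z.1 z.2)) ≤
        C * ENNReal.ofReal (max 1 (Real.sqrt T) + 1) := by
    intro T x₀
    have h1 : (0 : ℝ) < max 1 (Real.sqrt T) + 1 := by positivity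
    refine (lintegral_mono_set (Set.prod_mono (Ioo_subset_Ioo_rho_add_sq T zero_le_one)
      (ball_subset_ball (by linarith [one_le_rho T])))).trans (hGUb _ h1 x₀)
  -- ### the weakly continuous representative
  obtain ⟨U', hU'ae, hU'm, hU'bd, hU'lim, hU'cont⟩ :=
    exists_weaklyContinuous_representative hUsol hUm hAmono hUA
  obtain ⟨Ca, hCa⟩ := exists_forall_lintegral_ball_sq_le_of_memLp ha'
  set Uf : ℝ → EuclideanSpace ℝ (Fin 3) → EuclideanSpace ℝ (Fin 3) := fun t => if 0 < t then U' t else a'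
    with hUf_def
  have hUf_pos : ∀ t : ℝ, 0 < t → Uf t = U' t := fun t ht => by simp only [hUf_def, if_pos ht]
  have hUf_zero : Uf 0 = a' := by simp only [hUf_def, lt_irrefl, if_false]
  have hUf_ae : ∀ᵐ t ∂(volume.restrict (Ioi (0 : ℝ))), Uf t = U t := by
    filter_upwards [hU'ae, ae_restrict_mem measurableSet_Ioi] with t ht ht0
    rw [hUf_pos t ht0, ht]
  have hUf_aeT : ∀ T : ℝ, ∀ᵐ t ∂(volume.restrict (Ioo (0 : ℝ) T)), Uf t = U t := fun T =>
    ae_restrict_of_ae_restrict_of_subset Ioo_subset_Ioi_self hUf_ae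
  have hUf_prod : uncurry U =ᵐ[volume.restrict (Ioi (0 : ℝ) ×ˢ (univ : Set (EuclideanSpace ℝ (Fin 3))))] uncurry Uf :=
    (ae_eq_uncurry_of_ae_eq_slice measurableSet_Ioi hUf_ae).symm
  have hUf_prodT : ∀ T : ℝ,
      uncurry U =ᵐ[volume.restrict (Ioo (0 : ℝ) T ×ˢ (univ : Set (EuclideanSpace ℝ (Fin 3))))] uncurry Uf := fun T =>
    ae_restrict_of_ae_restrict_of_subset (Set.prod_mono Ioo_subset_Ioi_self Subset.rfl) hUf_prod
  -- slices of `Uf`: measurability and the every-time bound `B T = max (A (T+1)) Ca` on `[0, T]`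
  have hUf_meas : ∀ t : ℝ, 0 ≤ t → AEStronglyMeasurable (Uf t) volume := by
    intro t ht
    rcases eq_or_lt_of_le ht with rfl | ht'
    · rw [hUf_zero]; exact ha'.1
    · rw [hUf_pos t ht']; exact hU'm t ht'
  have hUf_bd : ∀ T t : ℝ, t ∈ Icc 0 T → ∀ x₀ : EuclideanSpace ℝ (Fin 3),
      ∫⁻ x in ball x₀ 1, ‖Uf t x‖ₑ ^ 2 ≤ max (A (T + 1)) Ca := by
    intro T t ht x₀
    rcases eq_or_lt_of_le ht.1 with h0 | ht'
    · rw [← h0, hUf_zero]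
      exact (hCa x₀).trans (ENNReal.coe_le_coe.2 (le_max_right _ _))
    · rw [hUf_pos t ht']
      exact (hU'bd t (T + 1) ht' (by linarith [ht.2]) x₀).trans (ENNReal.coe_le_coe.2 (le_max_left _ _))
  -- ### suitability of `(Uf, P)` and the weak gradient, transported along `U = Uf` a.e.
  have hsuit : IsSuitableWeakSolutionOn (slab (EuclideanSpace ℝ (Fin 3)) (Ioi 0) isOpen_Ioi) 1 0 Uf P :=
    hS.congr_ae (by rw [hslab]; exact hUf_prod) (Eventually.of_forall fun _ => rfl)
  have hGUf : HasWeakSpatialGradientOn (slab (EuclideanSpace ℝ (Fin 3)) (Ioi 0) isOpen_Ioi) Uf GU :=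
    hGU.congr_ae (by rw [hslab]; exact hUf_prod)
  have hslabT : ∀ T : ℝ, (slab (EuclideanSpace ℝ (Fin 3)) (Ioo 0 T) isOpen_Ioo : Opens (ℝ × EuclideanSpace ℝ (Fin 3))) ≤
      slab (EuclideanSpace ℝ (Fin 3)) (Ioi 0) isOpen_Ioi := fun T => slab_mono Ioo_subset_Ioi_self
  -- ### the traces (C1)
  have htrace : ∀ φ : EuclideanSpace ℝ (Fin 3) → EuclideanSpace ℝ (Fin 3),
      FunctionSpaces.IsTestFunctionOn (⊤ : Opens (EuclideanSpace ℝ (Fin 3))) φ →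
      ∀ t₀ : ℝ, 0 < t₀ → ∀ ℓ : ℕ → ℝ,
        (∀ k, Tendsto (fun t => ∫ x, ⟪v k t x, φ x⟫) (𝓝[<] t₀ ⊓ ae volume) (𝓝 (ℓ k))) →
        Tendsto ℓ atTop (𝓝 (∫ x, ⟪Uf t₀ x, φ x⟫)) := by
    intro φ hφ t₀ ht₀ ℓ hℓ
    haveI : (𝓝[<] t₀ ⊓ ae (volume : Measure ℝ)).NeBot := nhdsLT_inf_ae_neBot t₀
    haveI : ∀ t : ℝ, (𝓝 t ⊓ ae (volume : Measure ℝ)).NeBot := fun t => nhds_inf_ae_neBot t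
    set a₀ : ℝ := t₀ / 2 with ha₀_def
    set b₀ : ℝ := 2 * t₀ with hb₀_def
    have ha₀ : 0 < a₀ := by rw [ha₀_def]; positivity
    have hb₀ : 0 < b₀ := by rw [hb₀_def]; positivity
    have hmem : t₀ ∈ Ioo a₀ b₀ := ⟨by rw [ha₀_def]; linarith, by rw [hb₀_def]; linarith⟩
    -- ### the continuous versions of the pairings
    have hVk := fun k => exists_continuousOn_version_Ioo (hvsol k) ha₀ (b := b₀) hφ
    choose V hVc hVlim hVae hVinc using hVk
    obtain ⟨VU, hVUc, hVUlim, hVUae, -⟩ := exists_continuousOn_version_Ioo hUsol ha₀ (b := b₀) hφ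
    have hℓV : ∀ k, ℓ k = V k t₀ := fun k =>
      tendsto_nhds_unique (hℓ k) ((hVlim k t₀ hmem).mono_left (inf_le_inf_right _ nhdsWithin_le_nhds))
    have hUfV : (∫ x, ⟪Uf t₀ x, φ x⟫) = VU t₀ := by
      rw [hUf_pos t₀ ht₀]
      exact tendsto_nhds_unique (hU'lim φ hφ t₀ ht₀) (hVUlim t₀ hmem)
    -- ### the uniform modulus at `t₀`
    obtain ⟨R₀, hR₀⟩ := hφ.hasCompactSupport.isCompact.isBounded.subset_ball (0 : EuclideanSpace ℝ (Fin 3))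
    set R : ℝ := max R₀ 1 with hR_def
    have hRpos : 0 < R := by rw [hR_def]; positivity
    have hφR : tsupport φ ⊆ ball (0 : EuclideanSpace ℝ (Fin 3)) R := hR₀.trans (ball_subset_ball (le_max_left _ _))
    obtain ⟨D, hDq, -, -⟩ := hPbox b₀ R hb₀ hRpos
    obtain ⟨Km, hKm0, hmod⟩ := exists_modulus_slab (ν := (1 : ℝ)) zero_le_one hb₀ (A b₀) D R hφ hφR
    have hmodk : ∀ k, ∀ s ∈ Ioo a₀ b₀, s ≤ t₀ → |V k t₀ - V k s| ≤ Km * (t₀ - s) ^ (1 / 3 : ℝ) :=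
      fun k s hs hst => hmod (v k) (q k) (hvsol k) (hvA k b₀) (hDq k) ha₀ le_rfl (V k) (hVinc k) s hs t₀ hmem hst
    -- ### `L¹` convergence of the pairings on `]t₀ - δ, t₀[`
    obtain ⟨Cφ, hCφ⟩ := hφ.contDiff.continuous.bounded_above_of_compact_support hφ.hasCompactSupport
    have hCφ0 : 0 ≤ Cφ := (norm_nonneg _).trans (hCφ 0)
    have hL1 : ∀ δ : ℝ, 0 < δ → δ < t₀ / 2 →
        Tendsto (fun k => ∫⁻ s in Ioo (t₀ - δ) t₀, ‖V k s - VU s‖ₑ) atTop (𝓝 0) := by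
      intro δ hδ hδt
      set I : Set ℝ := Ioo (t₀ - δ) t₀ with hI_def
      have hIsub : I ⊆ Ioo a₀ b₀ := fun s hs => ⟨by rw [ha₀_def]; linarith [hs.1], hs.2.trans hmem.2⟩
      have hIsub' : I ⊆ Ioo 0 b₀ := fun s hs => ⟨ha₀.trans (hIsub hs).1, (hIsub hs).2⟩
      have hIsub0 : I ⊆ Ioo 0 t₀ := fun s hs => ⟨ha₀.trans (hIsub hs).1, hs.2⟩
      set B : Set (EuclideanSpace ℝ (Fin 3)) := ball (0 : EuclideanSpace ℝ (Fin 3)) R with hB_def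
      -- good slices on `(0, b₀)`
      have hslices : ∀ (w : ℝ → EuclideanSpace ℝ (Fin 3) → EuclideanSpace ℝ (Fin 3)),
          AEStronglyMeasurable (uncurry w) (volume.restrict (Ioi (0 : ℝ) ×ˢ (univ : Set (EuclideanSpace ℝ (Fin 3))))) →
          (∀ᵐ t ∂(volume.restrict (Ioo (0 : ℝ) b₀)), ∀ x₀ : EuclideanSpace ℝ (Fin 3), ∫⁻ x in ball x₀ 1, ‖w t x‖ₑ ^ 2 ≤ A b₀) →
          ∀ᵐ t ∂(volume.restrict I), AEStronglyMeasurable (w t) volume ∧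
            ∀ x₀ : EuclideanSpace ℝ (Fin 3), ∫⁻ x in ball x₀ 1, ‖w t x‖ₑ ^ 2 ≤ A b₀ := by
        intro w hwm hwA
        have hwm' : AEStronglyMeasurable (uncurry w)
            (volume.restrict (Ioo (0 : ℝ) b₀ ×ˢ (univ : Set (EuclideanSpace ℝ (Fin 3))))) :=
          hwm.mono_measure (Measure.restrict_mono (Set.prod_mono Ioo_subset_Ioi_self Subset.rfl) le_rfl)
        have h1 := ae_aestronglyMeasurable_slice_of_uncurry hwm'
        exact ae_restrict_of_ae_restrict_of_subset hIsub' (h1.and hwA)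
      -- pointwise (a.e. `s ∈ I`): `‖V k s - VU s‖ₑ ≤ Cφ ∫_B |v k s - U s|`
      have hpt : ∀ k, ∀ᵐ s ∂(volume.restrict I), ‖V k s - VU s‖ₑ ≤
          ENNReal.ofReal Cφ * ∫⁻ x in B, ‖v k s x - U s x‖ₑ := by
        intro k
        filter_upwards [hslices (v k) (hvm k) (hvA k b₀), hslices U hUm (hUA b₀),
          ae_restrict_of_ae_restrict_of_subset hIsub (hVae k), ae_restrict_of_ae_restrict_of_subset hIsub hVUae]
          with s hsv hsU hVs hVUs
        rw [← hVs, ← hVUs, ← integral_sub (integrable_inner_of_bound hsv.1 hsv.2 hφ) (integrable_inner_of_bound hsU.1 hsU.2 hφ)]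
        have e1 : (fun x => ⟪v k s x, φ x⟫ - ⟪U s x, φ x⟫) = fun x => ⟪v k s x - U s x, φ x⟫ := by
          funext x; rw [inner_sub_left]
        rw [e1, ← setIntegral_eq_integral_of_forall_compl_eq_zero (s := B) (fun x hx => by
          rw [image_eq_zero_of_notMem_tsupport (fun h' => hx (hφR h')), inner_zero_right])]
        calc ‖∫ x in B, ⟪v k s x - U s x, φ x⟫‖ₑ ≤ ∫⁻ x in B, ‖⟪v k s x - U s x, φ x⟫‖ₑ :=
              enorm_integral_le_lintegral_enorm _
          _ ≤ ∫⁻ x in B, ENNReal.ofReal Cφ * ‖v k s x - U s x‖ₑ := by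
              refine lintegral_mono fun x => ?_
              rw [← ofReal_norm, ← ofReal_norm, ← ENNReal.ofReal_mul hCφ0]
              refine ENNReal.ofReal_le_ofReal ((norm_inner_le_norm _ _).trans ?_)
              rw [mul_comm]
              exact mul_le_mul_of_nonneg_right (hCφ x) (norm_nonneg _)
          _ = ENNReal.ofReal Cφ * ∫⁻ x in B, ‖v k s x - U s x‖ₑ := lintegral_const_mul' _ _ ENNReal.ofReal_ne_top
      -- Tonelli and Hölder on `I × B`
      have hsubIB : I ×ˢ B ⊆ Ioi (0 : ℝ) ×ˢ (univ : Set (EuclideanSpace ℝ (Fin 3))) :=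
        Set.prod_mono (fun s hs => (hIsub' hs).1) (subset_univ _)
      have hmeasIB : ∀ k, AEStronglyMeasurable (fun z : ℝ × EuclideanSpace ℝ (Fin 3) => v k z.1 z.2 - U z.1 z.2)
          (volume.restrict (I ×ˢ B)) := fun k =>
        ((hvm k).sub hUm).mono_measure (Measure.restrict_mono hsubIB le_rfl)
      have hvolIB : volume (I ×ˢ B) ≠ ∞ := by
        rw [Measure.volume_eq_prod, Measure.prod_prod]
        exact ENNReal.mul_ne_top (by rw [hI_def, Real.volume_Ioo]; exact ENNReal.ofReal_ne_top) measure_ball_lt_top.ne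
      have hbd : ∀ k, ∫⁻ s in I, ‖V k s - VU s‖ₑ ≤ ENNReal.ofReal Cφ *
          ((∫⁻ z in Ioo 0 t₀ ×ˢ B, ‖v k z.1 z.2 - U z.1 z.2‖ₑ ^ 2) ^ (1 / 2 : ℝ) * volume (I ×ˢ B) ^ (1 / 2 : ℝ)) := by
        intro k
        have hTon : ∫⁻ s in I, ∫⁻ x in B, ‖v k s x - U s x‖ₑ = ∫⁻ z in I ×ˢ B, ‖v k z.1 z.2 - U z.1 z.2‖ₑ := by
          have h1 : AEMeasurable (fun z : ℝ × EuclideanSpace ℝ (Fin 3) => ‖v k z.1 z.2 - U z.1 z.2‖ₑ)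
              (((volume : Measure ℝ).restrict I).prod ((volume : Measure (EuclideanSpace ℝ (Fin 3))).restrict B)) := by
            rw [← volume_restrict_prod_eq]; exact (hmeasIB k).enorm
          rw [volume_restrict_prod_eq, lintegral_prod _ h1]
        calc ∫⁻ s in I, ‖V k s - VU s‖ₑ ≤ ∫⁻ s in I, ENNReal.ofReal Cφ * ∫⁻ x in B, ‖v k s x - U s x‖ₑ :=
              lintegral_mono_ae (hpt k)
          _ = ENNReal.ofReal Cφ * ∫⁻ z in I ×ˢ B, ‖v k z.1 z.2 - U z.1 z.2‖ₑ := by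
              rw [lintegral_const_mul' _ _ ENNReal.ofReal_ne_top, hTon]
          _ ≤ ENNReal.ofReal Cφ * ((∫⁻ z in I ×ˢ B, ‖v k z.1 z.2 - U z.1 z.2‖ₑ ^ 2) ^ (1 / 2 : ℝ) *
              volume (I ×ˢ B) ^ (1 / 2 : ℝ)) := by
              gcongr
              have h2 := setLIntegral_enorm_le_rpow_mul_measure_rpow (μ := volume) (hmeasIB k) (q := 2) (by norm_num)
              rw [show (1 - 1 / 2 : ℝ) = 1 / 2 by norm_num] at h2
              refine h2.trans_eq ?_
              congr 2
              exact lintegral_congr fun z => by rw [ENNReal.rpow_two]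
          _ ≤ ENNReal.ofReal Cφ * ((∫⁻ z in Ioo 0 t₀ ×ˢ B, ‖v k z.1 z.2 - U z.1 z.2‖ₑ ^ 2) ^ (1 / 2 : ℝ) *
              volume (I ×ˢ B) ^ (1 / 2 : ℝ)) :=
              mul_le_mul' le_rfl (mul_le_mul' (ENNReal.rpow_le_rpow
                (lintegral_mono_set (Set.prod_mono hIsub0 Subset.rfl)) (by norm_num)) le_rfl)
      have hRHS : Tendsto (fun k => ENNReal.ofReal Cφ *
          ((∫⁻ z in Ioo 0 t₀ ×ˢ B, ‖v k z.1 z.2 - U z.1 z.2‖ₑ ^ 2) ^ (1 / 2 : ℝ) * volume (I ×ˢ B) ^ (1 / 2 : ℝ)))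
          atTop (𝓝 0) := by
        have h1 := tendsto_rpow_half_zero (hL2 t₀ 0 R)
        have h2 := ENNReal.Tendsto.mul_const h1
          (Or.inr (ENNReal.rpow_ne_top_of_nonneg (y := (1 / 2 : ℝ)) (by norm_num) hvolIB))
        rw [zero_mul] at h2
        have h3 := ENNReal.Tendsto.const_mul (a := ENNReal.ofReal Cφ) h2 (Or.inr ENNReal.ofReal_ne_top)
        rwa [mul_zero] at h3
      exact tendsto_of_tendsto_of_tendsto_of_le_of_le tendsto_const_nhds hRHS (fun _ => bot_le) hbd
    -- ### the `ε`-argument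
    rw [hUfV]
    refine Metric.tendsto_nhds.2 fun ε₀ hε₀ => ?_
    set ε : ℝ := ε₀ / 2 with hε_def
    have hε : 0 < ε := by rw [hε_def]; positivity
    -- continuity of `VU` at `t₀`
    obtain ⟨δ₁, hδ₁, hδ₁c⟩ := Metric.continuousAt_iff.1 (hVUc.continuousAt (Icc_mem_nhds hmem.1 hmem.2)) (ε / 4) (by positivity)
    -- the layer thickness
    set ε' : ℝ := ε / (4 * (Km + 1)) with hε'_def
    have hε'0 : 0 < ε' := by rw [hε'_def]; positivity
    set δ : ℝ := min (min (t₀ / 4) (δ₁ / 2)) (ε' ^ 3) with hδ_def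
    have hδ0 : 0 < δ := by rw [hδ_def]; positivity
    have hδt : δ < t₀ / 2 := lt_of_le_of_lt ((min_le_left _ _).trans (min_le_left _ _)) (by linarith)
    have hδ₁' : δ < δ₁ := lt_of_le_of_lt ((min_le_left _ _).trans (min_le_right _ _)) (by linarith)
    have hδε : Km * δ ^ (1 / 3 : ℝ) ≤ ε / 4 := by
      have h1 : δ ^ (1 / 3 : ℝ) ≤ ε' := by
        calc δ ^ (1 / 3 : ℝ) ≤ (ε' ^ 3) ^ (1 / 3 : ℝ) := Real.rpow_le_rpow hδ0.le (min_le_right _ _) (by norm_num)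
          _ = ε' := by
              rw [show (1 / 3 : ℝ) = ((3 : ℕ) : ℝ)⁻¹ by norm_num]
              exact Real.pow_rpow_inv_natCast hε'0.le three_ne_zero
      calc Km * δ ^ (1 / 3 : ℝ) ≤ (Km + 1) * ε' := by gcongr; linarith
        _ = ε / 4 := by rw [hε'_def]; field_simp
    set I : Set ℝ := Ioo (t₀ - δ) t₀ with hI_def
    have hvolI : volume I = ENNReal.ofReal δ := by rw [hI_def, Real.volume_Ioo]; ring_nf
    have hvolI0 : volume I ≠ 0 := by rw [hvolI]; exact (ENNReal.ofReal_pos.2 hδ0).ne'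
    have hvolItop : volume I ≠ ∞ := by rw [hvolI]; exact ENNReal.ofReal_ne_top
    -- pointwise on `I`: `|V k t₀ - VU t₀| ≤ ε/2 + |V k s - VU s|`
    have hptI : ∀ k, ∀ s ∈ I, |V k t₀ - VU t₀| ≤ ε / 2 + |V k s - VU s| := by
      intro k s hs
      have hsab : s ∈ Ioo a₀ b₀ := ⟨by rw [ha₀_def]; linarith [hs.1], hs.2.trans hmem.2⟩
      have h1 : |V k t₀ - V k s| ≤ ε / 4 := by
        refine (hmodk k s hsab hs.2.le).trans ?_
        calc Km * (t₀ - s) ^ (1 / 3 : ℝ) ≤ Km * δ ^ (1 / 3 : ℝ) := by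
              refine mul_le_mul_of_nonneg_left (Real.rpow_le_rpow (by linarith [hs.2]) (by linarith [hs.1]) (by norm_num)) hKm0
          _ ≤ ε / 4 := hδε
      have h2 : |VU s - VU t₀| ≤ ε / 4 := by
        have := hδ₁c (x := s) (by rw [Real.dist_eq, abs_sub_lt_iff]; constructor <;> linarith [hs.1, hs.2])
        rw [Real.dist_eq] at this
        exact this.le
      have e : V k t₀ - VU t₀ = (V k t₀ - V k s) + (V k s - VU s) + (VU s - VU t₀) := by ring
      rw [e]
      calc |(V k t₀ - V k s) + (V k s - VU s) + (VU s - VU t₀)|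
          ≤ |V k t₀ - V k s| + |V k s - VU s| + |VU s - VU t₀| := abs_add_three _ _ _
        _ ≤ ε / 4 + |V k s - VU s| + ε / 4 := by gcongr
        _ = ε / 2 + |V k s - VU s| := by ring
    -- integrate over `I`
    have hint : ∀ k, ENNReal.ofReal |V k t₀ - VU t₀| * volume I ≤
        ENNReal.ofReal (ε / 2) * volume I + ∫⁻ s in I, ‖V k s - VU s‖ₑ := by
      intro k
      calc ENNReal.ofReal |V k t₀ - VU t₀| * volume I = ∫⁻ _ in I, ENNReal.ofReal |V k t₀ - VU t₀| := by
            rw [setLIntegral_const]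
        _ ≤ ∫⁻ s in I, (ENNReal.ofReal (ε / 2) + ‖V k s - VU s‖ₑ) := by
            refine setLIntegral_mono' measurableSet_Ioo fun s hs => ?_
            rw [← Real.enorm_eq_ofReal (abs_nonneg _), ← Real.enorm_eq_ofReal (by positivity), Real.enorm_abs]
            calc ‖V k t₀ - VU t₀‖ₑ = ‖|V k t₀ - VU t₀|‖ₑ := (Real.enorm_abs _).symm
              _ ≤ ‖ε / 2 + |V k s - VU s|‖ₑ := by
                  rw [Real.enorm_eq_ofReal (abs_nonneg _), Real.enorm_eq_ofReal (by positivity)]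
                  exact ENNReal.ofReal_le_ofReal (hptI k s hs)
              _ ≤ ‖ε / 2‖ₑ + ‖|V k s - VU s|‖ₑ := enorm_add_le _ _
              _ = ‖ε / 2‖ₑ + ‖V k s - VU s‖ₑ := by rw [Real.enorm_abs]
        _ = ENNReal.ofReal (ε / 2) * volume I + ∫⁻ s in I, ‖V k s - VU s‖ₑ := by
            rw [lintegral_add_left' aemeasurable_const, setLIntegral_const]
    -- choose `k₀`
    have hev := (ENNReal.tendsto_atTop_zero.1 (hL1 δ hδ0 hδt)) (ENNReal.ofReal (ε / 2) * volume I)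
      (ENNReal.mul_pos (ENNReal.ofReal_pos.2 (by positivity)).ne' hvolI0)
    obtain ⟨k₀, hk₀⟩ := hev
    refine eventually_atTop.2 ⟨k₀, fun k hk => ?_⟩
    rw [hℓV k, Real.dist_eq]
    have h1 : ENNReal.ofReal |V k t₀ - VU t₀| * volume I ≤ ENNReal.ofReal ε * volume I := by
      calc ENNReal.ofReal |V k t₀ - VU t₀| * volume I
          ≤ ENNReal.ofReal (ε / 2) * volume I + ENNReal.ofReal (ε / 2) * volume I := (hint k).trans (add_le_add le_rfl (hk₀ k hk))
        _ = ENNReal.ofReal ε * volume I := by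
            rw [← add_mul, ← ENNReal.ofReal_add (by positivity) (by positivity), add_halves]
    have h2 : ENNReal.ofReal |V k t₀ - VU t₀| ≤ ENNReal.ofReal ε := (ENNReal.mul_le_mul_iff_left hvolI0 hvolItop).1 h1
    have h3 : |V k t₀ - VU t₀| ≤ ε := (ENNReal.ofReal_le_ofReal_iff hε.le).1 h2
    -- strict inequality: rerun with `ε/2`? simpler: `≤ ε` and we need `< ε`; use `ε/2` bound via the same with… we adjust below
    exact lt_of_le_of_lt h3 (by rw [hε_def]; linarith)
  -- ### the initial datum (C2), the decay (C3) and the traces (C1)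
  have hinit : ∀ K : Set (EuclideanSpace ℝ (Fin 3)), IsCompact K →
      Tendsto (fun t => ∫⁻ x in K, ‖Uf t x - a' x‖ₑ ^ 2) (𝓝[>] 0) (𝓝 0) := by
    haveI : ∀ t : ℝ, (𝓝 t ⊓ ae (volume : Measure ℝ)).NeBot := fun t => nhds_inf_ae_neBot t
    -- (i) weakly continuous representatives of the approximants
    have hrep := fun k => exists_weaklyContinuous_representative (hvsol k) (hvm k) hAmono (hvA k)
    choose v' hv'ae hv'm hv'bd hv'lim hv'cont using hrep
    -- (ii) a dense sequence of centres
    obtain ⟨d, hd⟩ := TopologicalSpace.exists_dense_seq (EuclideanSpace ℝ (Fin 3))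
    have hcover : ∀ x : EuclideanSpace ℝ (Fin 3), ∃ i, x ∈ ball (d i) 1 := by
      intro x
      have hx : x ∈ closure (range d) := hd.closure_eq ▸ mem_univ x
      obtain ⟨y, ⟨i, rfl⟩, hy⟩ := Metric.mem_closure_iff.1 hx 1 one_pos
      exact ⟨i, by rwa [mem_ball]⟩
    -- (iii) the layer-good times in `(0, 1)`
    have hgoodL : ∀ᵐ t ∂(volume.restrict (Ioo (0 : ℝ) 1)),
        (∀ k i, eLpNorm (v k t - heatTest 1 (a k) t) 2 (volume.restrict (ball (d i) 1)) ≤ h t) ∧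
        (∀ k, v' k t = v k t) ∧
        (∀ k, AEStronglyMeasurable (v k t) volume ∧
          ∀ x₀ : EuclideanSpace ℝ (Fin 3), ∫⁻ x in ball x₀ 1, ‖v k t x‖ₑ ^ 2 ≤ A 1) := by
      have h1 : ∀ᵐ t ∂(volume.restrict (Ioo (0 : ℝ) 1)), ∀ k i,
          eLpNorm (v k t - heatTest 1 (a k) t) 2 (volume.restrict (ball (d i) 1)) ≤ h t :=
        ae_all_iff.2 fun k => ae_all_iff.2 fun i => hL k (d i)
      have h2 : ∀ᵐ t ∂(volume.restrict (Ioo (0 : ℝ) 1)), ∀ k, v' k t = v k t :=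
        ae_all_iff.2 fun k => ae_restrict_of_ae_restrict_of_subset Ioo_subset_Ioi_self (hv'ae k)
      have h3 : ∀ᵐ t ∂(volume.restrict (Ioo (0 : ℝ) 1)), ∀ k, AEStronglyMeasurable (v k t) volume ∧
          ∀ x₀ : EuclideanSpace ℝ (Fin 3), ∫⁻ x in ball x₀ 1, ‖v k t x‖ₑ ^ 2 ≤ A 1 := by
        refine ae_all_iff.2 fun k => ?_
        have hwm' : AEStronglyMeasurable (uncurry (v k))
            (volume.restrict (Ioo (0 : ℝ) 1 ×ˢ (univ : Set (EuclideanSpace ℝ (Fin 3))))) :=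
          (hvm k).mono_measure (Measure.restrict_mono (Set.prod_mono Ioo_subset_Ioi_self Subset.rfl) le_rfl)
        exact (ae_aestronglyMeasurable_slice_of_uncurry hwm').and (hvA k 1)
      filter_upwards [h1, h2, h3] with t ht1 ht2 ht3 using ⟨ht1, ht2, ht3⟩
    -- (iv) the layer bound passes to `U'` at layer-good times
    set M' : ℝ := M + (eLpNorm a' 3 volume).toReal with hM'
    have haM : ∀ n, eLpNorm (a n) 3 volume ≤ ENNReal.ofReal M' := fun n =>
      (ha n).2.2.trans (by rw [← ENNReal.ofReal_coe_nnreal]; exact ENNReal.ofReal_le_ofReal (by rw [hM']; linarith [ENNReal.toReal_nonneg (a := eLpNorm a' 3 volume)]))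
    have haLM : eLpNorm a' 3 volume ≤ ENNReal.ofReal M' := by
      rw [← ENNReal.ofReal_toReal ha'.eLpNorm_ne_top]
      exact ENNReal.ofReal_le_ofReal (by rw [hM']; linarith [M.coe_nonneg])
    have hlayerU : ∀ t ∈ Ioo (0 : ℝ) 1,
        ((∀ k i, eLpNorm (v k t - heatTest 1 (a k) t) 2 (volume.restrict (ball (d i) 1)) ≤ h t) ∧
          (∀ k, v' k t = v k t) ∧
          (∀ k, AEStronglyMeasurable (v k t) volume ∧
            ∀ x₀ : EuclideanSpace ℝ (Fin 3), ∫⁻ x in ball x₀ 1, ‖v k t x‖ₑ ^ 2 ≤ A 1)) →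
        ∀ i, eLpNorm (U' t - heatTest 1 a' t) 2 (volume.restrict (ball (d i) 1)) ≤ h t := by
      intro t ht hg i
      have hconv : ∀ ψ : EuclideanSpace ℝ (Fin 3) → EuclideanSpace ℝ (Fin 3),
          FunctionSpaces.IsTestFunctionOn (⊤ : Opens (EuclideanSpace ℝ (Fin 3))) ψ →
          Tendsto (fun n => ∫ x, ⟪v n t x, ψ x⟫) atTop (𝓝 (∫ x, ⟪U' t x, ψ x⟫)) := by
        intro ψ hψ
        have h1 := htrace ψ hψ t ht.1 (fun n => ∫ x, ⟪v n t x, ψ x⟫) (fun n => ?_)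
        · rwa [hUf_pos t ht.1] at h1
        · have h2 := hv'lim n ψ hψ t ht.1
          rw [hg.2.1 n] at h2
          exact h2.mono_left (inf_le_inf_right _ nhdsWithin_le_nhds)
      exact eLpNorm_sub_heatTest_le_of_tendsto one_pos ht.1 (fun n => (ha n).1) haM ha' haLM hw hconv (d i)
        (fun n => memLp_two_unitBall_of_bound (hg.2.2 n).1 (hg.2.2 n).2 (d i))
        (memLp_two_unitBall_of_bound (hU'm t ht.1) (fun x₀ => hU'bd t 2 ht.1 (by linarith [ht.2]) x₀) (d i))
        (fun n => hg.1 n i)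
    -- (v) the modulus `Φ t = h t + E₃ t |B₁|^{1/6}` and the bound on unit balls at layer-good times
    set V : ℝ≥0∞ := volume (ball (0 : EuclideanSpace ℝ (Fin 3)) 1) with hV
    have hVtop : V ≠ ∞ := measure_ball_lt_top.ne
    set r : ℝ := 1 / (2 : ℝ≥0∞).toReal - 1 / (3 : ℝ≥0∞).toReal with hr
    have hr0 : 0 ≤ r := by rw [hr, ENNReal.toReal_ofNat, ENNReal.toReal_ofNat]; norm_num
    set Vr : ℝ≥0∞ := V ^ r with hVr
    have hVrtop : Vr ≠ ∞ := ENNReal.rpow_ne_top_of_nonneg hr0 hVtop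
    set E₃ : ℝ → ℝ≥0∞ := fun t => eLpNorm (heatTest 1 a' t - a') 3 volume with hE₃
    have hE₃0 : Tendsto E₃ (𝓝[>] 0) (𝓝 0) := by
      have h1 : Tendsto (fun s : ℝ => eLpNorm (heatFlow a' s - a') 3 volume) (𝓝[≥] 0) (𝓝 0) :=
        tendsto_heatFlow_nhdsWithin_zero_holds ha' (by norm_num) (by norm_num)
      have h2 : Tendsto (fun t : ℝ => (1 : ℝ) * t) (𝓝[>] 0) (𝓝[≥] 0) := by
        refine tendsto_nhdsWithin_of_tendsto_nhds_of_eventually_within _ ?_ ?_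
        · have hc : Continuous fun t : ℝ => (1 : ℝ) * t := continuous_const.mul continuous_id
          have := (hc.tendsto (0 : ℝ)).mono_left (nhdsWithin_le_nhds (s := Ioi (0 : ℝ)))
          simpa using this
        · filter_upwards [self_mem_nhdsWithin] with t ht
          exact mul_nonneg zero_le_one (le_of_lt (mem_Ioi.1 ht))
      exact h1.comp h2
    set Φ : ℝ → ℝ≥0∞ := fun t => (h t : ℝ≥0∞) + E₃ t * Vr with hΦ
    have hΦ0 : Tendsto (fun t => Φ t ^ 2) (𝓝[>] 0) (𝓝 0) := by
      have hη' : Tendsto (fun t => (h t : ℝ≥0∞)) (𝓝[>] 0) (𝓝 0) := by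
        have := ENNReal.tendsto_coe.2 hh
        simpa using this
      have h1 : Tendsto (fun t => E₃ t * Vr) (𝓝[>] 0) (𝓝 0) := by
        have := ENNReal.Tendsto.mul_const hE₃0 (Or.inr hVrtop)
        rwa [zero_mul] at this
      have h2 : Tendsto Φ (𝓝[>] 0) (𝓝 0) := by simpa using hη'.add h1
      have := ((ENNReal.continuous_pow 2).tendsto 0).comp h2
      simpa [Function.comp_def] using this
    have hball : ∀ t ∈ Ioo (0 : ℝ) 1,
        ((∀ k i, eLpNorm (v k t - heatTest 1 (a k) t) 2 (volume.restrict (ball (d i) 1)) ≤ h t) ∧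
          (∀ k, v' k t = v k t) ∧
          (∀ k, AEStronglyMeasurable (v k t) volume ∧
            ∀ x₀ : EuclideanSpace ℝ (Fin 3), ∫⁻ x in ball x₀ 1, ‖v k t x‖ₑ ^ 2 ≤ A 1)) →
        ∀ i, ∫⁻ x in ball (d i) 1, ‖U' t x - a' x‖ₑ ^ 2 ≤ Φ t ^ 2 := by
      intro t ht hg i
      set μc : Measure (EuclideanSpace ℝ (Fin 3)) := volume.restrict (ball (d i) 1) with hμc
      have hW3 : MemLp (heatTest 1 a' t) 3 volume := (memLp_two_heatTest_restrict_ball one_pos ht.1.le ha' (d i)).1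
      have hm1 : AEStronglyMeasurable (U' t - heatTest 1 a' t) μc := ((hU'm t ht.1).sub hW3.1).restrict
      have hm2 : AEStronglyMeasurable (heatTest 1 a' t - a') μc := (hW3.1.sub ha'.1).restrict
      have hsplit : U' t - a' = (U' t - heatTest 1 a' t) + (heatTest 1 a' t - a') := by rw [sub_add_sub_cancel]
      have h1 : eLpNorm (U' t - a') 2 μc ≤ (h t : ℝ≥0∞) + E₃ t * Vr := by
        rw [hsplit]
        refine (eLpNorm_add_le hm1 hm2 one_le_two).trans (add_le_add (hlayerU t ht hg i) ?_)
        calc eLpNorm (heatTest 1 a' t - a') 2 μc ≤ eLpNorm (heatTest 1 a' t - a') 3 μc * μc univ ^ r :=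
              eLpNorm_le_eLpNorm_mul_rpow_measure_univ (by norm_num) hm2
          _ ≤ E₃ t * Vr := by
              have hμ : μc univ = V := by
                rw [hμc, Measure.restrict_apply_univ, hV]
                exact Measure.addHaar_ball_center volume (d i) 1
              rw [hμ]
              exact mul_le_mul' (eLpNorm_mono_measure _ Measure.restrict_le_self) le_rfl
      calc ∫⁻ x in ball (d i) 1, ‖U' t x - a' x‖ₑ ^ 2 = eLpNorm (U' t - a') 2 μc ^ 2 :=
            lintegral_enorm_sq_eq_eLpNorm_two_pow μc _
        _ ≤ Φ t ^ 2 := by gcongr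
    -- (vi) the pairings of `U' s - a'` converge along a.e. `s → t`
    have ha'loc : LocallyIntegrable a' volume := ha'.locallyIntegrable (by norm_num)
    have hlimW : ∀ t : ℝ, 0 < t → ∀ ψ : EuclideanSpace ℝ (Fin 3) → EuclideanSpace ℝ (Fin 3),
        FunctionSpaces.IsTestFunctionOn (⊤ : Opens (EuclideanSpace ℝ (Fin 3))) ψ →
        Tendsto (fun s => ∫ x, ⟪(U' s - a') x, ψ x⟫) (𝓝 t ⊓ ae (volume : Measure ℝ))
          (𝓝 (∫ x, ⟪(U' t - a') x, ψ x⟫)) := by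
      intro t ht ψ hψ
      have hIa : Integrable (fun x => ⟪a' x, ψ x⟫) volume :=
        integrable_inner_of_locallyIntegrable_of_hasCompactSupport ha'loc hψ.contDiff.continuous hψ.hasCompactSupport
      have hsplit : ∀ s : ℝ, 0 < s → (∫ x, ⟪(U' s - a') x, ψ x⟫) = (∫ x, ⟪U' s x, ψ x⟫) - ∫ x, ⟪a' x, ψ x⟫ := by
        intro s hs
        rw [← integral_sub (integrable_inner_of_bound (hU'm s hs) (fun x₀ => hU'bd s (s + 1) hs (lt_add_one s) x₀) hψ) hIa]
        refine integral_congr_ae (Eventually.of_forall fun x => ?_)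
        simp only [Pi.sub_apply, inner_sub_left]
      have h1 : Tendsto (fun s => ∫ x, ⟪U' s x, ψ x⟫) (𝓝 t ⊓ ae (volume : Measure ℝ)) (𝓝 (∫ x, ⟪U' t x, ψ x⟫)) := by
        refine (hU'lim ψ hψ t ht).congr' ?_
        have h2 := (ae_restrict_iff' measurableSet_Ioi).1 hU'ae
        filter_upwards [mem_inf_of_right (f := 𝓝 t) h2, mem_inf_of_left (f := 𝓝 t) (g := ae volume) (Ioi_mem_nhds ht)]
          with s hs hs0
        rw [hs hs0]
      rw [hsplit t ht]
      refine ((h1.sub tendsto_const_nhds)).congr' ?_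
      filter_upwards [mem_inf_of_left (f := 𝓝 t) (g := ae volume) (Ioi_mem_nhds ht)] with s hs
      exact (hsplit s hs).symm
    -- (vii) the `ε`-argument on a compact `K`
    intro K hK
    obtain ⟨F, hF⟩ := hK.elim_finite_subcover (fun i : ℕ => ball (d i) 1) (fun _ => isOpen_ball)
      (fun x _ => mem_iUnion.2 (hcover x))
    refine ENNReal.tendsto_nhds_zero.2 fun ε hε => ?_
    -- the target accuracy on each unit ball
    rcases eq_or_ne ε ⊤ with rfl | hεtop
    · exact Eventually.of_forall fun t => le_top
    set ε' : ℝ≥0 := ε.toNNReal / (F.card + 1) with hε'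
    have hε0' : 0 < ε.toNNReal := ENNReal.toNNReal_pos hε.ne' hεtop
    have hε'pos : 0 < ε' := by rw [hε']; positivity
    have hε'sum : (F.card : ℝ≥0∞) * ε' ≤ ε := by
      have h1 : (F.card : ℝ≥0) * ε' ≤ ε.toNNReal := by
        rw [← NNReal.coe_le_coe, hε']
        push_cast
        have hx : (0 : ℝ) ≤ ε.toReal := ENNReal.toReal_nonneg
        have hn : (0 : ℝ) ≤ (F.card : ℝ) := Nat.cast_nonneg _
        rw [show (F.card : ℝ) * (ε.toReal / ((F.card : ℝ) + 1)) =
          ε.toReal * ((F.card : ℝ) / ((F.card : ℝ) + 1)) by ring]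
        exact mul_le_of_le_one_right hx ((div_le_one (by positivity)).2 (by linarith))
      calc (F.card : ℝ≥0∞) * ε' = ((F.card * ε' : ℝ≥0) : ℝ≥0∞) := by push_cast; rfl
        _ ≤ ε.toNNReal := ENNReal.coe_le_coe.2 h1
        _ = ε := ENNReal.coe_toNNReal hεtop
    -- `Φ s ^ 2 ≤ ε'` for `s ∈ (0, τ)`
    have hevΦ : ∀ᶠ s in 𝓝[>] (0 : ℝ), Φ s ^ 2 ≤ ε' :=
      ((tendsto_order.1 hΦ0).2 (ε' : ℝ≥0∞) (by exact_mod_cast hε'pos)).mono fun s hs => hs.le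
    obtain ⟨τ, hτ, hτsub⟩ := mem_nhdsGT_iff_exists_Ioo_subset.1 hevΦ
    have hτ0 : 0 < τ := hτ
    have hgoodL' := (ae_restrict_iff' measurableSet_Ioo).1 hgoodL
    -- the bound for `t ∈ (0, min τ 1)`
    have hmain : ∀ t ∈ Ioo 0 (min τ 1), ∫⁻ x in K, ‖Uf t x - a' x‖ₑ ^ 2 ≤ ε := by
      intro t ht
      have ht0 : 0 < t := ht.1
      have htτ : t < τ := lt_of_lt_of_le ht.2 (min_le_left _ _)
      have ht1 : t < 1 := lt_of_lt_of_le ht.2 (min_le_right _ _)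
      rw [hUf_pos t ht0]
      have hper : ∀ i, ∫⁻ x in ball (d i) 1, ‖U' t x - a' x‖ₑ ^ 2 ≤ ε' := by
        intro i
        have hw2 : MemLp (U' t - a') 2 (volume.restrict (ball (d i) 1)) := by
          haveI : IsFiniteMeasure (volume.restrict (ball (d i) (1 : ℝ))) :=
            ⟨by rw [Measure.restrict_apply_univ]; exact measure_ball_lt_top⟩
          exact (memLp_two_unitBall_of_bound (hU'm t ht0) (fun x₀ => hU'bd t (t + 1) ht0 (lt_add_one t) x₀) (d i)).sub
            ((ha'.restrict (ball (d i) 1)).mono_exponent (by norm_num))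
        have hgood : ∀ᶠ s in 𝓝 t ⊓ ae (volume : Measure ℝ), AEStronglyMeasurable ((fun s => U' s - a') s) volume ∧
            ∫⁻ x in ball (d i) 1, ‖(fun s => U' s - a') s x‖ₑ ^ 2 ≤ ε' := by
          have hI : ∀ᶠ s in 𝓝 t ⊓ ae (volume : Measure ℝ), s ∈ Ioo 0 (min τ 1) :=
            mem_inf_of_left (Ioo_mem_nhds ht0 ht.2)
          filter_upwards [hI, mem_inf_of_right (f := 𝓝 t) hgoodL'] with s hs hsg
          have hs0 : 0 < s := hs.1
          have hs1 : s < 1 := lt_of_lt_of_le hs.2 (min_le_right _ _)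
          have hsτ : s < τ := lt_of_lt_of_le hs.2 (min_le_left _ _)
          refine ⟨(hU'm s hs0).sub ha'.1, ?_⟩
          have h1 := hball s ⟨hs0, hs1⟩ (hsg ⟨hs0, hs1⟩) i
          have h2 : Φ s ^ 2 ≤ ε' := hτsub ⟨hs0, hsτ⟩
          exact h1.trans h2
        exact lintegral_unitBall_le_of_tendsto_pairing (d i) hw2 hgood (hlimW t ht0)
      calc ∫⁻ x in K, ‖U' t x - a' x‖ₑ ^ 2 ≤ ∫⁻ x in ⋃ i ∈ F, ball (d i) 1, ‖U' t x - a' x‖ₑ ^ 2 :=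
            lintegral_mono_set hF
        _ ≤ F.card * (ε' : ℝ≥0∞) := lintegral_biUnion_finset_le_card_mul F (fun i => ball (d i) 1) _ fun i _ => hper i
        _ ≤ ε := hε'sum
    filter_upwards [Ioo_mem_nhdsGT (show (0 : ℝ) < min τ 1 by positivity)] with t ht using hmain t ht
  -- weak continuity at `t = 0⁺` from the strong attainment of the datum
  have hwc0 : ∀ ψ : EuclideanSpace ℝ (Fin 3) → EuclideanSpace ℝ (Fin 3),
      FunctionSpaces.IsTestFunctionOn (⊤ : Opens (EuclideanSpace ℝ (Fin 3))) ψ →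
      Tendsto (fun t => ∫ x, ⟪Uf t x, ψ x⟫) (𝓝[>] 0) (𝓝 (∫ x, ⟪a' x, ψ x⟫)) := by
    intro ψ hψ
    set K : Set (EuclideanSpace ℝ (Fin 3)) := tsupport ψ with hK
    have hKc : IsCompact K := hψ.hasCompactSupport
    obtain ⟨Cψ, hCψ⟩ := hψ.contDiff.continuous.bounded_above_of_compact_support hψ.hasCompactSupport
    have hCψ0 : 0 ≤ Cψ := (norm_nonneg _).trans (hCψ 0)
    have ha'loc : LocallyIntegrable a' volume := ha'.locallyIntegrable (by norm_num)
    have hIa : Integrable (fun x => ⟪a' x, ψ x⟫) volume :=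
      integrable_inner_of_locallyIntegrable_of_hasCompactSupport ha'loc hψ.contDiff.continuous hψ.hasCompactSupport
    -- the bound `‖∫⟪Uf t - a', ψ⟫‖ₑ ≤ Cψ (∫_K |Uf t - a'|²)^{1/2} |K|^{1/2}` for `t > 0`
    have hbound : ∀ t : ℝ, 0 < t → ‖(∫ x, ⟪Uf t x, ψ x⟫) - ∫ x, ⟪a' x, ψ x⟫‖ₑ ≤
        ENNReal.ofReal Cψ * ((∫⁻ x in K, ‖Uf t x - a' x‖ₑ ^ 2) ^ (1 / 2 : ℝ) * volume K ^ (1 / 2 : ℝ)) := by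
      intro t ht
      have hUt : AEStronglyMeasurable (Uf t) volume := hUf_meas t ht.le
      have hIU : Integrable (fun x => ⟪Uf t x, ψ x⟫) volume := by
        rw [hUf_pos t ht]
        exact integrable_inner_of_bound (hU'm t ht) (fun x₀ => hU'bd t (t + 1) ht (lt_add_one t) x₀) hψ
      have e : (∫ x, ⟪Uf t x, ψ x⟫) - ∫ x, ⟪a' x, ψ x⟫ = ∫ x in K, ⟪Uf t x - a' x, ψ x⟫ := by
        rw [← integral_sub hIU hIa]
        have e1 : (fun x => ⟪Uf t x, ψ x⟫ - ⟪a' x, ψ x⟫) = fun x => ⟪Uf t x - a' x, ψ x⟫ := by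
          funext x; rw [inner_sub_left]
        rw [e1]
        refine (setIntegral_eq_integral_of_forall_compl_eq_zero fun x hx => ?_).symm
        rw [image_eq_zero_of_notMem_tsupport hx, inner_zero_right]
      rw [e]
      have hm : AEStronglyMeasurable (fun x => Uf t x - a' x) (volume.restrict K) := (hUt.sub ha'.1).restrict
      calc ‖∫ x in K, ⟪Uf t x - a' x, ψ x⟫‖ₑ ≤ ∫⁻ x in K, ‖⟪Uf t x - a' x, ψ x⟫‖ₑ :=
            enorm_integral_le_lintegral_enorm _
        _ ≤ ∫⁻ x in K, ENNReal.ofReal Cψ * ‖Uf t x - a' x‖ₑ := by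
            refine lintegral_mono fun x => ?_
            rw [← ofReal_norm, ← ofReal_norm, ← ENNReal.ofReal_mul hCψ0]
            refine ENNReal.ofReal_le_ofReal ((norm_inner_le_norm _ _).trans ?_)
            rw [mul_comm]
            exact mul_le_mul_of_nonneg_right (hCψ x) (norm_nonneg _)
        _ = ENNReal.ofReal Cψ * ∫⁻ x in K, ‖Uf t x - a' x‖ₑ := lintegral_const_mul' _ _ ENNReal.ofReal_ne_top
        _ ≤ ENNReal.ofReal Cψ * ((∫⁻ x in K, ‖Uf t x - a' x‖ₑ ^ 2) ^ (1 / 2 : ℝ) * volume K ^ (1 / 2 : ℝ)) := by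
            gcongr
            have h2 := setLIntegral_enorm_le_rpow_mul_measure_rpow (μ := volume) hm (q := 2) (by norm_num)
            rw [show (1 - 1 / 2 : ℝ) = 1 / 2 by norm_num] at h2
            refine h2.trans_eq ?_
            congr 2
            exact lintegral_congr fun x => by rw [ENNReal.rpow_two]
    -- the right-hand side tends to `0`
    have hRHS : Tendsto (fun t => ENNReal.ofReal Cψ *
        ((∫⁻ x in K, ‖Uf t x - a' x‖ₑ ^ 2) ^ (1 / 2 : ℝ) * volume K ^ (1 / 2 : ℝ))) (𝓝[>] 0) (𝓝 0) := by
      have h1 : Tendsto (fun t => (∫⁻ x in K, ‖Uf t x - a' x‖ₑ ^ 2) ^ (1 / 2 : ℝ)) (𝓝[>] 0) (𝓝 0) := by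
        have hc : Tendsto (fun x : ℝ≥0∞ => x ^ (1 / 2 : ℝ)) (𝓝 0) (𝓝 0) := by
          have := (ENNReal.continuous_rpow_const (y := (1 / 2 : ℝ))).tendsto 0
          simpa [ENNReal.zero_rpow_of_pos (show (0 : ℝ) < 1 / 2 by norm_num)] using this
        exact hc.comp (hinit K hKc)
      have hKvol : volume K ≠ ∞ := hKc.measure_lt_top.ne
      have h2 := ENNReal.Tendsto.mul_const h1
        (Or.inr (ENNReal.rpow_ne_top_of_nonneg (y := (1 / 2 : ℝ)) (by norm_num) hKvol))
      rw [zero_mul] at h2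
      have h3 := ENNReal.Tendsto.const_mul (a := ENNReal.ofReal Cψ) h2 (Or.inr ENNReal.ofReal_ne_top)
      rwa [mul_zero] at h3
    -- conclusion
    rw [tendsto_iff_edist_tendsto_0]
    refine tendsto_of_tendsto_of_tendsto_of_le_of_le' tendsto_const_nhds hRHS
      (Eventually.of_forall fun _ => bot_le) ?_
    filter_upwards [self_mem_nhdsWithin] with t ht
    rw [edist_eq_enorm_sub]
    exact hbound t ht
  have hwc : ∀ T : ℝ, ∀ ψ : EuclideanSpace ℝ (Fin 3) → EuclideanSpace ℝ (Fin 3),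
      FunctionSpaces.IsTestFunctionOn (⊤ : Opens (EuclideanSpace ℝ (Fin 3))) ψ →
      ContinuousOn (fun t => ∫ x, ⟪Uf t x, ψ x⟫) (Icc 0 T) := by
    intro T ψ hψ t ht
    rcases eq_or_lt_of_le ht.1 with h0 | ht'
    · -- at `t = 0`: right continuity
      rw [← h0]
      refine ContinuousWithinAt.mono ?_ Icc_subset_Ici_self
      rw [← continuousWithinAt_Ioi_iff_Ici]
      show Tendsto (fun t => ∫ x, ⟪Uf t x, ψ x⟫) (𝓝[>] 0) (𝓝 (∫ x, ⟪Uf 0 x, ψ x⟫))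
      rw [hUf_zero]
      exact hwc0 ψ hψ
    · -- at `t > 0`: the weak continuity of `U'`
      have h1 : ContinuousAt (fun t => ∫ x, ⟪U' t x, ψ x⟫) t :=
        ((hU'cont ψ hψ) t ht').continuousAt (Ioi_mem_nhds ht')
      have h2 : (fun t => ∫ x, ⟪Uf t x, ψ x⟫) =ᶠ[𝓝 t] fun t => ∫ x, ⟪U' t x, ψ x⟫ := by
        filter_upwards [Ioi_mem_nhds ht'] with s hs
        rw [hUf_pos s hs]
      exact (h1.congr_of_eventuallyEq h2).continuousWithinAt
  -- the local pressure expansion of the limit, on every `(0, T)`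
  have hexp : ∀ T : ℝ, 0 < T → ∀ (x₀ : EuclideanSpace ℝ (Fin 3)) (r : ℝ), 0 < r →
      ∀ᵐ t ∂(volume.restrict (Ioo (0 : ℝ) T)), ∃ κ : ℝ,
        ∀ᵐ x ∂(volume.restrict (ball x₀ r)),
          P t x = localPressureNear x₀ r Uf t x + localPressureFar x₀ r Uf t x + κ := by
    intro T hT x₀ r hr
    have hsubT : Ioo (0 : ℝ) T ×ˢ (univ : Set (EuclideanSpace ℝ (Fin 3))) ⊆ Ioi (0 : ℝ) ×ˢ univ :=
      Set.prod_mono Ioo_subset_Ioi_self Subset.rfl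
    have hUmT : AEStronglyMeasurable (uncurry U)
        (volume.restrict (Ioo (0 : ℝ) T ×ˢ (univ : Set (EuclideanSpace ℝ (Fin 3))))) :=
      hUm.mono_measure (Measure.restrict_mono hsubT le_rfl)
    have hPmT : AEStronglyMeasurable (uncurry P)
        (volume.restrict (Ioo (0 : ℝ) T ×ˢ (univ : Set (EuclideanSpace ℝ (Fin 3))))) :=
      hPm.mono_measure (Measure.restrict_mono hsubT le_rfl)
    have hPlT : LocallyIntegrableOn (uncurry P) (Ioo (0 : ℝ) T ×ˢ (univ : Set (EuclideanSpace ℝ (Fin 3)))) volume := by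
      have h1 : LocallyIntegrableOn (uncurry P) (Ioi (0 : ℝ) ×ˢ (univ : Set (EuclideanSpace ℝ (Fin 3)))) volume := by
        rw [← hslab]; exact hUsol.2.2.1
      exact h1.mono_set hsubT
    have hC₂ : (C : ℝ≥0∞) * ENNReal.ofReal (max 1 (Real.sqrt T) + 1) ≠ ∞ :=
      ENNReal.mul_ne_top ENNReal.coe_ne_top ENNReal.ofReal_ne_top
    have hU3 : ∀ R : ℝ, 0 < R → ∫⁻ z in Ioo 0 T ×ˢ ball (0 : EuclideanSpace ℝ (Fin 3)) R, ‖U z.1 z.2‖ₑ ^ (3 : ℕ) < ∞ :=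
      fun R _ => lintegral_cube_box_lt_top_of_bounds hUmT (A := A T) ENNReal.coe_ne_top (hUA T)
        (hGU.mono (hslabT T)) hC₂ (hGUunit T) 0 R
    have hexpU := ae_slice_pressure_expansion_of_limit (T := T) (ν := 1) (A T)
      (fun k => (hv k).isLocalLeraySolutionOn T) (fun k => hvA k T) hUmT hPmT hPlT (hPfin T hT) (hUA T) hU3
      (fun R _ => hL2 T 0 R) (fun R hR => (hPbox T R hT hR).choose_spec.2.2) x₀ r hr
    filter_upwards [hexpU, hUf_aeT T] with t ht hUt
    obtain ⟨κ, hκ⟩ := ht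
    refine ⟨κ, hκ.mono fun x hx => ?_⟩
    simp only [localPressureNear_apply, localPressureFar_apply, hUt] at hx ⊢
    exact hx
  have hdiv : IsWeaklyDivFree a' := IsWeaklyDivFree.of_tendsto_integral_inner (fun k => (ha k).2.1) hw
  have hdecay : ∀ R : ℝ, 0 < R →
      Tendsto (fun x₀ : EuclideanSpace ℝ (Fin 3) => ∫⁻ z in Ioo 0 (R ^ 2) ×ˢ ball x₀ R, ‖Uf z.1 z.2‖ₑ ^ 2)
        (cocompact (EuclideanSpace ℝ (Fin 3))) (𝓝 0) := by
    intro R hR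
    set T : ℝ := R ^ 2 with hT_def
    have hT : 0 < T := by positivity
    set CLD : ℝ≥0 := max (max (A (T + 1)) Ca) (C * (max 1 (Real.sqrt T) + 1).toNNReal) with hCLD
    refine hLD (ν := 1) (T := T) one_pos hT CLD a' Uf P (memE2_of_memLp ha' (by norm_num) (by norm_num)) hdiv
      (hsuit.of_le (hslabT T)) (hPfin T hT) (fun t ht => hUf_meas t ht.1)
      (fun t ht x₀ => (hUf_bd T t ht x₀).trans (ENNReal.coe_le_coe.2 (le_max_left _ _)))
      ⟨GU, hGUf.mono (hslabT T), fun x₀ => (hGUunit T x₀).trans ?_⟩ (hwc T) hinit (hexp T hT) R hR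
    rw [coe_mul_ofReal]
    exact ENNReal.coe_le_coe.2 (le_max_right _ _)
  -- ### assembly
  refine ⟨Uf, hUf_prod.symm, ⟨hsuit, ?_, ?_, ?_, ⟨GU, hGUf, ?_⟩, hinit, hdecay⟩, ?_, htrace⟩
  · -- `Uf ∈ L²((0,T) × K)`
    intro T hT K hK
    obtain ⟨R, hR⟩ := hK.isBounded.subset_ball (0 : EuclideanSpace ℝ (Fin 3))
    have h1 : ∫⁻ z in Ioo 0 T ×ˢ K, ‖Uf z.1 z.2‖ₑ ^ 2 ≤ ∫⁻ z in Ioo 0 T ×ˢ ball (0 : EuclideanSpace ℝ (Fin 3)) R, ‖Uf z.1 z.2‖ₑ ^ 2 :=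
      lintegral_mono_set (Set.prod_mono Subset.rfl hR)
    refine lt_of_le_of_lt h1 ?_
    have h2 : ∫⁻ z in Ioo 0 T ×ˢ ball (0 : EuclideanSpace ℝ (Fin 3)) R, ‖Uf z.1 z.2‖ₑ ^ 2 =
        ∫⁻ z in Ioo 0 T ×ˢ ball (0 : EuclideanSpace ℝ (Fin 3)) R, ‖U z.1 z.2‖ₑ ^ 2 := by
      refine lintegral_congr_ae ?_
      have h3 := ae_restrict_of_ae_restrict_of_subset (Ioo_prod_ball_subset_slab T 0 R) hUf_prod
      filter_upwards [h3] with z hz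
      show ‖uncurry Uf z‖ₑ ^ 2 = ‖uncurry U z‖ₑ ^ 2
      rw [hz]
    rw [h2]
    exact hcube2 U hUm hUA T 0 R
  · -- `P ∈ L^{3/2}((0,T) × K)`
    exact fun T hT K hK => hPfin T hT K hK
  · -- uniformly local energy on `(0, R²)`
    intro R hR
    obtain ⟨N, hN, -⟩ := Seregin2014Limit.exists_cover_const R
    refine ⟨N * A (R ^ 2), ?_⟩
    filter_upwards [hUA (R ^ 2), hUf_aeT (R ^ 2)] with t ht hUt x₀
    rw [hUt]
    calc ∫⁻ x in ball x₀ R, ‖U t x‖ₑ ^ 2 ≤ N * A (R ^ 2) := hN _ _ ht x₀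
      _ = ((N * A (R ^ 2) : ℝ≥0) : ℝ≥0∞) := by push_cast; rfl
  · -- uniformly local gradient bound
    intro R hR
    refine ⟨C * R.toNNReal, fun x₀ => ?_⟩
    rw [← coe_mul_ofReal]
    exact hGUb R hR x₀
  · -- weak continuity on `(0, ∞)`
    intro φ hφ
    exact (hU'cont φ hφ).congr fun t ht => by rw [hUf_pos t ht]

/-- **Discharge of `localLeray_limit_isLocalLeraySolution`** (Jia–Šverák 2013, proof of Thm. 1,
p. 8: the identification of the limit of a sequence of Leray solutions as a Leray solution with the
weak-limit datum): the reduction `localLeray_limit_isLocalLeraySolution_of_limit_decay` applied to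
the discharge `seregin2014_limit_decay_holds` of Seregin's Thm. 1.6.
[cite: JiaSverak2013, proof of Thm. 1 (arXiv:1201.1592 p. 8)] [cite: Seregin2014, App. B Thm. 1.6 and §B.4] -/
theorem localLeray_limit_isLocalLeraySolution_holds : localLeray_limit_isLocalLeraySolution :=
  localLeray_limit_isLocalLeraySolution_of_limit_decay seregin2014_limit_decay_holds

end Literature.Analysis.FluidPDE

end
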